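import Summits.KontsevichZagierPeriods.KontsevichZagierPeriods.Theses.VietaFibre
import Summits.KontsevichZagierPeriods.KontsevichZagierPeriods.Theorems.InverseLandauTateLiftingDepolarisationSum

/-!
# `DepolarisationSum` (stmt-KontsevichZagierPeriods-5153, route VietaFibre) — proof

The depolarisation sum of route `VietaFibre`: for rationals `a, b, c > 0` and
`D_α(x) = α²(1 − x) + x`, every representation `[(0,1), abc √(1−x)/√(D_a D_b D_c) ·
(1/D_a + 1/D_b + 1/D_c)]` (pinned by its domain and by its integrand on it) is `KZ.Equivalent` to
every constant representation `[pt, 2]` over the point. It is, verbatim,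
`Summit.KontsevichZagierPeriods.InverseLandau.tateLifting_depolarisationSum` (stub 74 of the line
`Sketch` of the crux `TateLifting`, stmt-KontsevichZagierPeriods-9129, lead c10): ONE Newton–Leibniz
move over the point with the algebraic primitive `−2abc (1 − x)^{3/2}/√(D_a D_b D_c)`.
-/

namespace Summit.KontsevichZagierPeriods.VietaFibre

/-- **`DepolarisationSum`** (route VietaFibre, stmt-KontsevichZagierPeriods-5153): for rationals
`a, b, c > 0`, `[(0,1), abc √(1−x)/√(D_a D_b D_c) · Σ 1/D_α] ∼ [pt, 2]` in the Kontsevich–Zagier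
calculus (`D_α = α²(1 − x) + x`). Proof: `InverseLandau.tateLifting_depolarisationSum` (one
Newton–Leibniz move over the point, primitive `−2abc(1−x)^{3/2}/√(D_a D_b D_c)`).
[cite: KontsevichZagier2001, §1.2] -/
theorem depolarisationSum_proof :
    Summit.KontsevichZagierPeriods.KontsevichZagierPeriods.Theses.VietaFibre.DepolarisationSum :=
  Summit.KontsevichZagierPeriods.InverseLandau.tateLifting_depolarisationSum

end Summit.KontsevichZagierPeriods.VietaFibre
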